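import Literature.NumberTheory.EllipticCurves.Rank1Residual.Typed.KimCertificate
import Literature.NumberTheory.EllipticCurves.Rank1Residual.Predicates
import Literature.NumberTheory.EllipticCurves.BSDSelmerPConverseSerreProofs
import HarnessLib

/-!
# X4 ∧ `r_an = 1` at `p = 3`: the RANK-ONE clauses of "Kim 2026 Thm. 1.9 at `p = 3`" TYPED in Kim's
# binder shape (`5 ≤ p` removed, tower binder added), STEP-0 at `p ≥ 5`, and the `p = 3` conjectures
# (cell `b2b-bsdres`, team n1011, sub-target T-a2r1 = the `r = 1` twin of T-a2; §I item O7 ∩ N11)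

HONEST FRAMING (cell `b2b-bsdres`, run/shared/lean/b2b/bsd-rank1-residual/, verbatim in every
file): the goal of the cell is to DELETE the COMBINATION-SHAPED residual classes of the
Birch–Swinnerton-Dyer formula for ALL analytic-rank `≤ 1` elliptic curves over `ℚ` — "full BSD
formula for every rank `≤ 1` curve in class `C`" assembled STRICTLY from published theorems — so
that the rank-`≤ 1` remainder becomes exactly the CONSTRUCTION-SHAPED classes, which are TYPED
(missing-input `Prop`s), NOT attempted. This is not "finishing BSD". Team n1011: prove what is
provable now; shrink each hard class to its core with data; no claim beyond stated classes;
research routes; census output = EVIDENCE / conjecture items, never a Literature fact. X4 stays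
CONSTRUCTION-SHAPED; nothing here is booked; no RESIDUAL-MAP mark moves (§I O7 / N11 unchanged).

## What this file does (statements only: six `@[conjecture] def`s + STEP-0 + bookkeeping)

The tree's PUBLISHED rank-one Kurihara-number facts (C.-H. Kim, Amer. J. Math. 148 (2026) Thm. 1.8
= arXiv:2203.12159v4 Thm. 1.9 (1), (4), (6); `Literature/…/KuriharaNumberKimShaLength.lean`)
`Kim2022_rankOne_card_sha_eq_one_of_kuriharaNumber_ne_zero_of_maninConstant` (l. 284: ONE unit
Kurihara number `δ̃_ℓ ≢ 0 (mod p)` at a Kolyvagin prime `ℓ ∈ 𝒫₁` ⇒ `#Ш(E/ℚ)(p) = 1`) and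
`Kim2022_rankOne_padicValNat_sha_le_one_of_kuriharaNumber_levelTwo_ne_zero_of_maninConstant`
(l. 345: `δ̃_ℓ ≢ 0 (mod p²)` at `ℓ ∈ 𝒫₂` ⇒ `ord_p #Ш(E/ℚ)(p) ≤ 1`) carry NO reduction hypothesis at
`p` (additive reduction included, §1.3.5 / Prop. 3.2 / Lemma 3.10 of the paper). Their ONLY binder
that fails on the residual item O7 ∩ X4 at `p = 3` (RESIDUAL-MAP §I O7: X4 ∧ `r = 1`, 10 677 cells
at `3`; S-b 10 105 surj(3) pairs; "Heegner route structurally blocked, `p ∣ I_K` on every census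
pair") is `5 ≤ p`. Kim himself locates it (arXiv v4 §1.2.5, PDF p. 5, verbatim): "If `ρ̄` is
surjective and `p ≥ 5`, then all the required hypotheses for the Kolyvagin system argument are
satisfied [mazur-rubin-book]. … The `p ≥ 5` condition is required only for the Chebotarev density
type argument in [mazur-rubin-book], and it seems possible to extend to the `p = 3` case following
the recent work of Sakamoto [sakamoto-p-selmer]." (Mazur–Rubin's hypothesis (H.4) "either
`Ā ≄ Ā*` or `p ≥ 5`" fails for `T₃E` by the Weil pairing; R. Sakamoto, Doc. Math. 27 (2022) =
arXiv:2106.03370, §2 p. 5: "`T` does not satisfy the hypothesis (H.4) in [MRkoly] when `p = 3`",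
App. §5 "Remarks on `p = 3`".) The second job of `5 ≤ p` at `p ≥ 5` — Serre's "surj(p) ⇒
`ρ̄_{E,pⁿ}` onto for all `n`" (tree THEOREM `serre_hasSurjectiveModNGaloisRep_pow_holds`), feeding
Kato's integrality condition (12.5.2) — is NOT automatic at `3` (Elkies' 9-deficient family; tree
`Kato2004.imageContainsSL2_three_iff_hasSurjectiveModNGaloisRep_nine`), so it becomes a binder.

LITERATURE STATUS (team lead, PLAN.md §1 item 3 / OWNERS T-a4, 2026-08-21): the `p = 3` case is
ANNOUNCED in a PREPRINT — C.-H. Kim (appendix with R. Pollack), *The refined Tamagawa number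
conjectures for GL₂*, arXiv:2505.09121v1 (May 2025), Thm. 1.1 (Str)/("BSD") (PDF p. 4): for
`f ∈ S_k(Γ₀(N))`, `p ≥ 3`, `ρ_f` of LARGE IMAGE (:= the image of `Gal(ℚ̄/ℚ(μ_{p^∞}))` contains a
conjugate of `SL₂(ℤ_p)` = Kato's (12.5.2) = the tower below) and a NON-VANISHING collection of
Kurihara numbers `δ^{min}` (minimal integral periods): `cork Sel = ord(δ^{min})`,
`length Sel_{/div} = ∂^{(ord)}(δ^{min}) − ∂^{(∞)}(δ^{min})` — "independent of weight or the local
behavior of `f` at `p`" (PDF p. 5); the `p = 3` Chebotarev step by R. Sakamoto, *The theory of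
Kolyvagin systems for `p = 3`*, JTNB 36 (2024) 919–946 (PUBLISHED). Its rank-one NON-VANISHING clause
Thm. 1.2 (rk1+ε) and its BSD-currency Cor. 1.10 both require `p² ∤ N` and are NOT available at an
additive `3`; they are not needed here, because in the certificate shapes below the non-vanishing
of `δ̃` is WITNESSED by the certificate (`δ̃_ℓ ≠ 0`) — so the `r = 1` clauses at `3` rest on
Thm. 1.1 (Str) + Gross–Zagier–Kolyvagin (rank `= 1`, `Ш` finite; supplied by the consumers) + the
period-normalisation bridge `Ω^±_{f,min}` ↔ the tree's `Ω⁺_f`/Néron normalisation (team row T-a0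
(γ)). A preprint is not a Literature fact (cell rule): the statements stay `@[conjecture]` here; if
row T-a4 lands a cited `_OPEN` def of Thm. 1.1, the bridge `X4SharpThreeKimRankOne ⟸ (that def) ∧
(normalisation)` is the follow-up, under referee 1's placement ruling.

CONVENTION = team row T-a2's (sibling `Additive/X4SharpThreeKimShape.lean`, rank `0`): per-pair
predicates in Kim's binder shape with `5 ≤ p →` REMOVED and the TOWER binder
`(∀ n, W.HasSurjectiveModNGaloisRep (p ^ n)) →` ADDED right after `W.HasSurjectiveModNGaloisRep p →`;
every other binder byte-identical to the tree fact; then the universal closures at `p = 3` for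
every `E/ℚ` (`KimThreeRankOne*`, as printed: no reduction binder) and restricted to an additive
`3` (`X4SharpThreeKimRankOne*` — the O7 ∩ X4@3 hypotheses).

* §1 `KimRankOneUnitAt W p`, `KimRankOneLevelTwoAt W p` (per pair; `@[conjecture]`: open exactly
  at `p = 3`) + STEP-0: at `5 ≤ p` they ARE the printed theorem (`…_of_five_le`), and the family
  over all `p ≥ 5` is EQUIVALENT to the printed fact (`forall_…_iff_kim`, Serre for `⇒`) — so the
  ONLY new content of the `p = 3` closures is the prime `3`.
* §2 `KimThreeRankOne`, `KimThreeRankOneLevelTwo`, `X4SharpThreeKimRankOne`,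
  `X4SharpThreeKimRankOneLevelTwo` (`@[conjecture]`; OPEN; our paraphrase of "Kim 2026 Thm. 1.9
  (1)(4)(6) at `p = 3`", NOT a Literature fact, never to be cited as Kim) + the class-X4
  unpacking lemmas (`KimThreeRankOne* ⇒ X4SharpThreeKimRankOne*` is the obvious restriction; not
  stated as a theorem so that no audit reads an implication between conjectures as a proof).
  Any further `p = 3` binder that T-a3's dependency map of Kim's proof forces is added as a
  SHARPENED definition (append-only), never edited in.

Consumers (per pair `BSD(E,p) ⟺ ord_p #Ш_an = 0` from one unit `δ̃_ℓ`; level two + Cassels–Tate;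
consistency on closed rows; the falsifiable prediction; the `p = 3` census shapes) live in the
sibling `Additive/X4SharpThreeKimRankOneConsequences.lean` (theorems only).

Binder-by-binder against `Additive.X4SharpRankOne` (SharpenedStatements l. 228: `∀ W p,
r_an = 1 → ClassX4 W p → Surj W p → MissingPPartAt W p`, every odd `p`, NO certificate): the
conjectures here are WEAKER in shape — they deliver `Ш[p^∞] = 0` (resp. `ord_p #Ш ≤ 1`) only at a
pair CARRYING a Kurihara-number certificate, the tower, a Manin datum and the period transfer;
`MissingPPartAt W 3` then follows on the `3 ∤ #Ш_an` rows (sibling file). They say nothing at `p ≥ 5`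
beyond the printed theorem and nothing on non-surjective (O8) or `3`-adically exotic rows.

References: Kim 2026 [Kim2022StructureSelmer] Thm. 1.9 (1)(4)(6), §1.2.2, §1.2.5, §1.3.5, §1.4.3–4,
§1.5.1, Conj. 1.10; Kim 2025 preprint [Kim2025RefinedTNC] arXiv:2505.09121 Thm. 1.1, Thm. 1.2, Cor. 1.10, §3
(flag `Kim2025-preprint`; cited `_OPEN` channel `Literature/…/Kim2025/LargeImageStructureOPEN.lean`, T-a4); Sakamoto
2022 [Sakamoto2022pSelmer] §2, App. §5; Sakamoto 2024 [Sakamoto2024KolyvaginThree] Thm. 1.1 = 4.4,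
Lemma 5.2, Cor. 5.5; Rubin, PCMS 18 (2011) §2.4
(H.1)–(H.4), §3.4 (3.4); Serre 1972 [Serre1972] IV §3.4; Miller 2011 [Miller2011LMS] Def. 1.1; cell
files RESIDUAL-MAP.md §I O7 / N11, CLASS-CLOSURE-PLAN.md §3.1 / §3.3, cells/n1011/OWNERS.md rows
T-a2, T-a2r1, T-a3; skeleton cells/n1011/skel/T-a2r1.md.
-/

noncomputable section

open scoped Classical MatrixGroups ModularForm

open CongruenceSubgroup WeierstrassCurve Literature.NumberTheory.EllipticCurves
  Literature.NumberTheory.EllipticCurves.ModularForms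
  Literature.NumberTheory.EllipticCurves.Rank1Residual
  Literature.NumberTheory.EllipticCurves.Rank1Residual.Typed

namespace Summit.BirchSwinnertonDyer.Rank1Residual.Additive

/-! ## §1 The two per-pair predicates (Kim's rank-one binder shapes, `5 ≤ p` removed, tower added) -/

/-- **Kim's clauses (1), (4), (6) at the pair `(E, p)`, analytic rank `1`, UNIT Kurihara number at a
prime Kolyvagin level**: the body of the tree fact
`Kim2022_rankOne_card_sha_eq_one_of_kuriharaNumber_ne_zero_of_maninConstant` at `(W, p)` with the
binder `5 ≤ p` REMOVED and the tower binder `∀ n, ρ̄_{E,pⁿ}` onto ADDED (at `p ≥ 5` a consequence of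
surj(p), Serre; at `p = 3` the census certificate SURJ9 / `j`-witness): `ρ̄_{E,p}` onto, tower onto,
`L(E,1) = 0`, `r_an = 1`, `Ш(E/ℚ)` finite, a datum `D` with `p ∤ c_D`, the period transfer
`Ω(W) = u·Ω⁺_{D.f}`, `|u|_p = 1`, a Kolyvagin prime `ℓ ∈ 𝒫₁(E,p)` with `#Ẽ(𝔽_ℓ)[p] ≤ p`, `ψ_ℓ`
onto, ONE unit `kuriharaNumber D.f p ℓ ψ ≠ 0` ⟹ `#Ш(E/ℚ)(p) = 1`. A predicate on `(W, p)`;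
nothing asserted; a THEOREM at `5 ≤ p` (`kimRankOneUnitAt_of_five_le`), conjectural at `p = 3`.
[cite: Kim2022StructureSelmer, Thm. 1.9 (1), (4), (6) (PDF pp. 7–8), §1.2.5 (PDF p. 5), §1.3.5 (PDF p. 6)] -/
@[conjecture] def KimRankOneUnitAt (W : WeierstrassCurve ℚ) [W.IsElliptic] [W.IsGloballyMinimal]
    (p : ℕ) [Fact p.Prime] : Prop :=
  W.HasSurjectiveModNGaloisRep p → (∀ n : ℕ, W.HasSurjectiveModNGaloisRep (p ^ n : ℕ)) →
    W.entireLFunction 1 = 0 → W.analyticRank = 1 → Finite W.sha →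
    ∀ {N : ℕ} [NeZero N] (D : ModularParametrizationData W N),
    ¬ (p : ℤ) ∣ D.maninConstant →
    (∃ u : ℚ, ‖(u : ℚ_[p])‖ = 1 ∧ W.realPeriodRat = u * plusPeriod D.f) →
    ∀ (ℓ : ℕ) [Fact ℓ.Prime], Kato.IsKolyvaginPrime W p 1 ℓ →
    Nat.card {P : ((WeierstrassCurve.integralModelInt W).map
        (Int.castRingHom (ZMod ℓ))).toAffine.Point // p • P = 0} ≤ p →
    ∀ ψ : (ℓ' : ℕ) → (ZMod ℓ')ˣ →* Multiplicative (ZMod (p ^ 1)),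
      Function.Surjective (ψ ℓ) →
      kuriharaNumber D.f (p ^ 1) ℓ ψ ≠ 0 →
    Nat.card (AddCommGroup.primaryComponent W.sha p) = 1

/-- **Kim's clause (6) at the pair `(E, p)`, analytic rank `1`, Kurihara number NON-ZERO MODULO `p²`
at a Kolyvagin prime of LEVEL TWO: `ord_p #Ш(E/ℚ)(p) ≤ 1`** — the body of the tree fact
`Kim2022_rankOne_padicValNat_sha_le_one_of_kuriharaNumber_levelTwo_ne_zero_of_maninConstant` at
`(W, p)` with `5 ≤ p` REMOVED and the tower binder ADDED; aimed at the rank-one rows with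
`ord_p ∏ c_ℓ = 1`, where Kim's Conjecture 1.10 forbids a unit. Nothing asserted; a THEOREM at
`5 ≤ p` (`kimRankOneLevelTwoAt_of_five_le`), conjectural at `p = 3`.
[cite: Kim2022StructureSelmer, Thm. 1.9 (6) (PDF p. 8), §1.2.2 (PDF p. 5), §1.5.1 (PDF p. 7), §1.2.5 (PDF p. 5)] -/
@[conjecture] def KimRankOneLevelTwoAt (W : WeierstrassCurve ℚ) [W.IsElliptic] [W.IsGloballyMinimal]
    (p : ℕ) [Fact p.Prime] : Prop :=
  W.HasSurjectiveModNGaloisRep p → (∀ n : ℕ, W.HasSurjectiveModNGaloisRep (p ^ n : ℕ)) →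
    W.entireLFunction 1 = 0 → W.analyticRank = 1 → Finite W.sha →
    ∀ {N : ℕ} [NeZero N] (D : ModularParametrizationData W N),
    ¬ (p : ℤ) ∣ D.maninConstant →
    (∃ u : ℚ, ‖(u : ℚ_[p])‖ = 1 ∧ W.realPeriodRat = u * plusPeriod D.f) →
    ∀ (ℓ : ℕ) [Fact ℓ.Prime], Kato.IsKolyvaginPrime W p 2 ℓ →
    Nat.card {P : ((WeierstrassCurve.integralModelInt W).map
        (Int.castRingHom (ZMod ℓ))).toAffine.Point // p • P = 0} ≤ p →
    ∀ ψ : (ℓ' : ℕ) → (ZMod ℓ')ˣ →* Multiplicative (ZMod (p ^ 2)),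
      Function.Surjective (ψ ℓ) →
      kuriharaNumber D.f (p ^ 2) ℓ ψ ≠ 0 →
    padicValNat p (Nat.card (AddCommGroup.primaryComponent W.sha p)) ≤ 1

variable (W : WeierstrassCurve ℚ) [W.IsElliptic] [W.IsGloballyMinimal] (p : ℕ) [Fact p.Prime]

/-- **STEP-0 in the kernel (unit clause): at `5 ≤ p` the per-pair predicate IS Kim's theorem** (tree
fact `hKim`; the tower binder is simply not used). [cite: Kim2022StructureSelmer, Thm. 1.9 (1), (4), (6) (PDF pp. 7–8)] -/
theorem kimRankOneUnitAt_of_five_le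
    (hKim : Kim2022_rankOne_card_sha_eq_one_of_kuriharaNumber_ne_zero_of_maninConstant)
    (hp : 5 ≤ p) : KimRankOneUnitAt W p :=
  fun hsurj _ hL hr hfin _ _ D hc hper ℓ _ hℓ hcyc ψ hψ hδ =>
    hKim W p hp hsurj hL hr hfin D hc hper ℓ hℓ hcyc ψ hψ hδ

/-- **STEP-0 in the kernel (level-two clause): at `5 ≤ p` the per-pair predicate IS Kim's theorem**
(tree fact `hKim2`). [cite: Kim2022StructureSelmer, Thm. 1.9 (6) (PDF p. 8), §1.2.2, §1.5.1] -/
theorem kimRankOneLevelTwoAt_of_five_le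
    (hKim2 :
      Kim2022_rankOne_padicValNat_sha_le_one_of_kuriharaNumber_levelTwo_ne_zero_of_maninConstant)
    (hp : 5 ≤ p) : KimRankOneLevelTwoAt W p :=
  fun hsurj _ hL hr hfin _ _ D hc hper ℓ _ hℓ hcyc ψ hψ hδ =>
    hKim2 W p hp hsurj hL hr hfin D hc hper ℓ hℓ hcyc ψ hψ hδ

omit [W.IsElliptic] [W.IsGloballyMinimal] [Fact p.Prime] in
/-- A tower of surjective mod-`pⁿ` representations is surjective mod `p` (`n = 1`). [folklore] -/
theorem hasSurjectiveModNGaloisRep_of_tower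
    (htower : ∀ n : ℕ, W.HasSurjectiveModNGaloisRep (p ^ n : ℕ)) :
    W.HasSurjectiveModNGaloisRep p := by
  simpa using htower 1

/-- **STEP-0, binder-faithfulness (unit clause)**: the family of per-pair predicates over ALL
`p ≥ 5` is EQUIVALENT to the printed fact — `⇒` by Serre's theorem
(`serre_hasSurjectiveModNGaloisRep_pow_holds`: surj(p) gives the tower at `p ≥ 5`), `⇐` by
`kimRankOneUnitAt_of_five_le`. So the only new content of the `p = 3` closures is the prime `3`.
[cite: Serre1972, IV §3.4 Lemme 3 (p. IV-23)] [cite: Kim2022StructureSelmer, Thm. 1.9 (1), (4), (6) (PDF pp. 7–8)] -/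
theorem forall_kimRankOneUnitAt_iff_kim :
    (∀ (W : WeierstrassCurve ℚ) [W.IsElliptic] [W.IsGloballyMinimal] (p : ℕ) [Fact p.Prime],
        5 ≤ p → KimRankOneUnitAt W p) ↔
      Kim2022_rankOne_card_sha_eq_one_of_kuriharaNumber_ne_zero_of_maninConstant := by
  constructor
  · intro h W _ _ p _ hp hsurj hL hr hfin N _ D hc hper ℓ _ hℓ hcyc ψ hψ hδ
    exact h W p hp hsurj (serre_hasSurjectiveModNGaloisRep_pow_holds W p hp hsurj) hL hr hfin D hc
      hper ℓ hℓ hcyc ψ hψ hδ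
  · intro hKim W _ _ p _ hp
    exact kimRankOneUnitAt_of_five_le W p hKim hp

/-- **STEP-0, binder-faithfulness (level-two clause)**: the family over all `p ≥ 5` is EQUIVALENT to
the printed fact (Serre for `⇒`). [cite: Serre1972, IV §3.4 Lemme 3 (p. IV-23)]
[cite: Kim2022StructureSelmer, Thm. 1.9 (6) (PDF p. 8)] -/
theorem forall_kimRankOneLevelTwoAt_iff_kim :
    (∀ (W : WeierstrassCurve ℚ) [W.IsElliptic] [W.IsGloballyMinimal] (p : ℕ) [Fact p.Prime],
        5 ≤ p → KimRankOneLevelTwoAt W p) ↔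
      Kim2022_rankOne_padicValNat_sha_le_one_of_kuriharaNumber_levelTwo_ne_zero_of_maninConstant := by
  constructor
  · intro h W _ _ p _ hp hsurj hL hr hfin N _ D hc hper ℓ _ hℓ hcyc ψ hψ hδ
    exact h W p hp hsurj (serre_hasSurjectiveModNGaloisRep_pow_holds W p hp hsurj) hL hr hfin D hc
      hper ℓ hℓ hcyc ψ hψ hδ
  · intro hKim2 W _ _ p _ hp
    exact kimRankOneLevelTwoAt_of_five_le W p hKim2 hp

/-! ## §2 The conjectures at `p = 3` (nothing asserted; not Literature) -/

/-- **Conjecture `KimThreeRankOne` — "Kim 2026 Thm. 1.9 (1)(4)(6) remain valid at `p = 3` in analytic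
rank `1`"** in Kim's binder shape, for EVERY `E/ℚ` (no reduction binder, as printed), under `3`-adic
TOWER surjectivity: `∀ W, KimRankOneUnitAt W 3` (ONE unit Kurihara number `δ̃_ℓ ≢ 0 (mod 3)` at a
cyclic `ℓ ∈ 𝒫₁(E,3)` ⟹ `Ш(E/ℚ)[3^∞] = 0`). Kim §1.2.5: `p ≥ 5` enters only through Mazur–Rubin's
Chebotarev argument (hypothesis (H.4) `p ≥ 5` for self-dual `T`), supplied at `3` by Sakamoto, JTNB
36 (2024); ANNOUNCED for `p ≥ 3` under large image as Kim, arXiv:2505.09121 Thm. 1.1 (Str) (PREPRINT,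
minimal-integral-period normalisation; its (rk1+ε)/Cor. 1.10 need `p² ∤ N` and are not used: the
certificate witnesses non-vanishing). OPEN in the tree (a preprint is not a fact); team n1011 row
T-a2r1; nothing asserted. PRINTED REASON (PRE, flag `Kim2025-preprint`, referee 1 RA3/ACK-1): the
ANNOUNCED Kim 2025 Thm. 1.1 (Str) and the REFEREED Sakamoto 2024 Thm. 1.1 (cited `_OPEN` channel:
`Kim2025.rankOne_card_sha_eq_one_of_kuriharaNumber_ne_zero_of_towerSurj_OPEN`, team row T-a4).
[cite: Kim2025RefinedTNC, Thm. 1.1 (Str)/("BSD") (PDF pp. 4–5; ANNOUNCED preprint — the reason, not a source of truth)]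
[cite: Kim2022StructureSelmer, Thm. 1.9 (1), (4), (6), §1.2.5 (PDF p. 5)]
[cite: Sakamoto2022pSelmer, App. §5 (Remarks on p = 3)] [cite: Sakamoto2024KolyvaginThree, Thm. 1.1] -/
@[conjecture] def KimThreeRankOne : Prop :=
  ∀ (W : WeierstrassCurve ℚ) [W.IsElliptic] [W.IsGloballyMinimal], KimRankOneUnitAt W 3

/-- **Conjecture `KimThreeRankOneLevelTwo` — "Kim 2026 Thm. 1.9 (6) remains valid at `p = 3` in
analytic rank `1`, level-two shape"**: `∀ W, KimRankOneLevelTwoAt W 3` (`δ̃_ℓ ≢ 0 (mod 9)` at a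
cyclic `ℓ ∈ 𝒫₂(E,3)` ⟹ `ord₃ #Ш(E/ℚ) ≤ 1`). OPEN; nothing asserted. PRINTED REASON (PRE): Kim 2025
Thm. 1.1 (Str) gives `length Sel_{/div} = ∂^{(1)} − ∂^{(∞)} ≤ 1` from `δ̃_ℓ ≢ 0 (mod 9)` at `p ≥ 3` under
large image (ANNOUNCED; no level-two `_OPEN` def typed yet by T-a4).
[cite: Kim2025RefinedTNC, Thm. 1.1 (Str) (PDF p. 4; ANNOUNCED preprint — the reason, not a source of truth)]
[cite: Kim2022StructureSelmer, Thm. 1.9 (6), §1.2.5 (PDF p. 5)] [cite: Sakamoto2022pSelmer, App. §5]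
[cite: Sakamoto2024KolyvaginThree, Thm. 1.1] -/
@[conjecture] def KimThreeRankOneLevelTwo : Prop :=
  ∀ (W : WeierstrassCurve ℚ) [W.IsElliptic] [W.IsGloballyMinimal], KimRankOneLevelTwoAt W 3

/-- **Conjecture X4♯(3)-Kim, rank one = THE O7 ∩ X4@3 HYPOTHESIS in Kim's binder shape**:
`KimThreeRankOne` restricted to an ADDITIVE `3` (`Addv W 3`; with the predicate's surj(3) binder
this is exactly the class `ClassX4 W 3`). Its per-pair use (sibling file): on an X4 ∧ `r_an = 1`
row at `3` with a tower certificate and an optimal datum with `3 ∤ c`, ONE unit Kurihara number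
at `3` gives `Ш(E/ℚ)[3^∞] = 0`, hence `BSD(E,3)` iff `3 ∤ #Ш_an` — the first per-pair lever on the
potentially GOOD rank-one X4@3 rows (Heegner route: `3 ∣ I_K` throughout the census); on a row where
`BSD(E,3)` is known with `3 ∣ #Ш_an` it PREDICTS that no prime-level Kurihara number at `3` is a
unit (falsifiable by the census). The `r = 1` twin of `X4SharpThreeKimUnit` (T-a2). OPEN;
nothing asserted; PRINTED REASON (PRE, flag `Kim2025-preprint`): Kim 2025 Thm. 1.1 / Sakamoto 2024,
bridged in the kernel by `x4SharpThreeKimRankOne_of_kim2025_OPEN` (sibling `…Bridge.lean`); the 21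
S-b rows with `3`-adically EXOTIC image (surj(3), no tower) stay OUTSIDE this statement.
[cite: Kim2025RefinedTNC, Thm. 1.1 (Str) (PDF p. 4; ANNOUNCED preprint — the reason, not a source of truth)]
[cite: Sakamoto2024KolyvaginThree, Thm. 1.1] -/
@[conjecture] def X4SharpThreeKimRankOne : Prop :=
  ∀ (W : WeierstrassCurve ℚ) [W.IsElliptic] [W.IsGloballyMinimal], Addv W 3 → KimRankOneUnitAt W 3

/-- **Conjecture X4♯(3)-Kim, rank one, level two**: `KimThreeRankOneLevelTwo` restricted to an
additive `3`; with Cassels–Tate it closes the rank-one X4@3 rows with `ord₃ ∏ c_ℓ = 1` and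
`3 ∤ #Ш_an` from ONE `δ̃_ℓ ≢ 0 (mod 9)` (sibling file). OPEN; nothing asserted; PRINTED REASON
(PRE, flag `Kim2025-preprint`): Kim 2025 Thm. 1.1 (Str) / Sakamoto 2024.
[cite: Kim2025RefinedTNC, Thm. 1.1 (Str) (PDF p. 4; ANNOUNCED preprint — the reason, not a source of truth)]
[cite: Sakamoto2024KolyvaginThree, Thm. 1.1] -/
@[conjecture] def X4SharpThreeKimRankOneLevelTwo : Prop :=
  ∀ (W : WeierstrassCurve ℚ) [W.IsElliptic] [W.IsGloballyMinimal],
    Addv W 3 → KimRankOneLevelTwoAt W 3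

/-- On class X4 at `3` (`ClassX4 W 3 = 3 ≠ 2 ∧ Addv W 3 ∧ Irr W 3`) the restricted conjecture yields the
per-pair predicate. Bookkeeping. [folklore] -/
theorem kimRankOneUnitAt_three_of_classX4 (h : X4SharpThreeKimRankOne) (hX : ClassX4 W 3) :
    KimRankOneUnitAt W 3 :=
  h W hX.2.1

/-- Level-two twin of `kimRankOneUnitAt_three_of_classX4`. Bookkeeping. [folklore] -/
theorem kimRankOneLevelTwoAt_three_of_classX4 (h : X4SharpThreeKimRankOneLevelTwo)
    (hX : ClassX4 W 3) : KimRankOneLevelTwoAt W 3 :=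
  h W hX.2.1

end Summit.BirchSwinnertonDyer.Rank1Residual.Additive

end
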